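import Literature.AlgebraicGeometry.Frobenioids.NonPreservationOfUnits
import HarnessLib

/-!
# Frobenioids I, §3, Example 3.9 under the inverse-action convention: the printed law holds

Mochizuki, *The geometry of Frobenioids I: the general theory*, Kyushu J. Math. **62** (2008)
293–400, kurims text p. 72 [cite: MochizukiFrdI2008, Ex. 3.9 p.72].

`NonPreservationOfUnits.lean` records (erratum candidate E1, convention-level) that under the LITERAL
reading of "`g ∈ G` that projects to `n ∈ N` acts on `V × W` by `(n, 1)`" as the pull-back `Φ(g)`, the
`V`-coordinate of a composite in `End_C` is `n_ψ v_φ + m_φ v_ψ`, not the printed `v₁ + m₁ n₁ v₂`.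
This file PROVES the positive statement announced there: if `Φ(g)` is read as the INVERSE of the
displayed automorphism (`V ∋ v ↦ n⁻¹ v` — the same convention as "`n ∈ N` acts on `U` by `n⁻¹`" in the
definition of `G`), and `End_C` is coordinatised by `(u, v', w, n, m)` with `v' := n · v`, then the
evident bijection `End_C ≃ M` IS an isomorphism of monoids for the PRINTED law of `M`
(`endLaw_covariant`).  So the printed Example 3.9 is exactly right under one global convention; which
convention the author intends is not decided here (recorded neutrally; referee audit E1).
-/

namespace Literature.AlgebraicGeometry.Frobenioids

open CategoryTheory

namespace Ex39

open RatSemidirect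

/-- `(g⁻¹).n = g.n⁻¹` in `G = U ⋊ N`. [cite: MochizukiFrdI2008, Ex. 3.8 p.71] -/
@[simp] theorem inv_n (g : G) : (g⁻¹).n = g.n⁻¹ := rfl

/-- The inverse-convention action: `g` acts on `V × W` by `(n⁻¹, 1)`. [cite: MochizukiFrdI2008, Ex. 3.9 p.72] -/
def act' (g : G) : Multiplicative (ℚ × ℕ) →* Multiplicative (ℚ × ℕ) := act g⁻¹

/-- Values of `act'`. [cite: MochizukiFrdI2008, Ex. 3.9 p.72] -/
@[simp] theorem toAdd_act' (g : G) (z : Multiplicative (ℚ × ℕ)) :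
    Multiplicative.toAdd (act' g z) =
      (((g.n : ℚ))⁻¹ * (Multiplicative.toAdd z).1, (Multiplicative.toAdd z).2) := by
  simp [act', toAdd_act, Positive.coe_inv]

/-- `act'` is compatible with the product of `G`. [cite: MochizukiFrdI2008, Ex. 3.9 p.72] -/
theorem act'_mul (g g' : G) : act' (g * g') = (act' g').comp (act' g) := by
  refine MonoidHom.ext fun z => Multiplicative.toAdd.injective ?_
  simp only [toAdd_act', MonoidHom.coe_comp, Function.comp_apply, G.mul_n, Positive.val_mul,
    mul_inv, Prod.mk.injEq]
  exact ⟨by ring, trivial⟩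

/-- `act' 1 = id`. [cite: MochizukiFrdI2008, Ex. 3.9 p.72] -/
theorem act'_one : act' 1 = MonoidHom.id _ := by
  refine MonoidHom.ext fun z => Multiplicative.toAdd.injective ?_
  simp [toAdd_act', Positive.val_one]

/-- The monoid `Φ'` on `D` under the inverse convention, as a functor `Dᵒᵖ ⥤ CommMonCat`.
[cite: MochizukiFrdI2008, Ex. 3.9 p.72] -/
def Φ' : Dᵒᵖ ⥤ CommMonCat.{0} where
  obj _ := CommMonCat.of (Multiplicative (ℚ × ℕ))
  map f := CommMonCat.ofHom (act' (show G from f.unop))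
  map_id A := by
    ext x : 2
    change act' 1 x = x
    rw [act'_one]; rfl
  map_comp f g := by
    ext x : 2
    change act' ((show G from f.unop) * (show G from g.unop)) x = act' _ (act' _ x)
    rw [act'_mul]; rfl

/-- The object of `C' := F_{Φ'}`. [cite: MochizukiFrdI2008, Ex. 3.9 p.72] -/
abbrev obj' : ElemFrobenioid Φ' := ElemFrobenioid.of Φ' (SingleObj.star G)

/-- The twisted coordinates `End_{C'} ≃ M`: `(Base = (u, n), Div = (v, w), deg_Fr = m) ↦ (u, n·v, w, n, m)`.
[cite: MochizukiFrdI2008, Ex. 3.9 p.72] -/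
def endEquivSet' : End obj' ≃ M where
  toFun φ := ⟨(ElemFrobenioid.Base φ).u,
    ((ElemFrobenioid.Base φ).n : ℚ) * (Multiplicative.toAdd (ElemFrobenioid.Div φ)).1,
    (Multiplicative.toAdd (ElemFrobenioid.Div φ)).2, (ElemFrobenioid.Base φ).n, ElemFrobenioid.degFr φ⟩
  invFun x := ElemFrobenioid.homMk (⟨x.u, x.n⟩ : G)
    (Multiplicative.ofAdd (((x.n : ℚ))⁻¹ * x.v, x.w)) x.m
  left_inv φ := by
    refine ElemFrobenioid.Hom.ext rfl ?_ rfl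
    refine Multiplicative.toAdd.injective (Prod.ext ?_ rfl)
    show ((ElemFrobenioid.Base φ).n : ℚ)⁻¹ *
        (((ElemFrobenioid.Base φ).n : ℚ) * (Multiplicative.toAdd (ElemFrobenioid.Div φ)).1) = _
    rw [← mul_assoc, inv_mul_cancel₀ (ne_of_gt (ElemFrobenioid.Base φ).n.2), one_mul]
  right_inv x := by
    refine M.ext rfl ?_ rfl rfl rfl
    show (x.n : ℚ) * (((x.n : ℚ))⁻¹ * x.v) = x.v
    rw [← mul_assoc, mul_inv_cancel₀ (ne_of_gt x.n.2), one_mul]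

/-- **Example 3.9 under the inverse-action convention** (PROVED): with `Φ(g) := (n⁻¹, 1)` and the
coordinates `(u, n·v, w, n, m)` on `End_C`, the bijection `End_C ≃ M` is multiplicative for the PRINTED
law `(u₁,v₁,w₁,n₁,m₁)·(u₂,v₂,w₂,n₂,m₂) = (u₁ + n₁⁻¹u₂, v₁ + m₁n₁v₂, w₁ + m₁w₂, n₁n₂, m₁m₂)` of
FrdI p. 72 (composition `φ ∘ ψ` via Def. 1.1 (iii): `Div(φ∘ψ) = ψ_D^*Div(φ) + deg_Fr(φ)·Div(ψ)`).
[cite: MochizukiFrdI2008, Ex. 3.9 p.72] -/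
theorem endLaw_covariant (φ ψ : End obj') :
    endEquivSet' (φ * ψ) = endEquivSet' φ * endEquivSet' ψ := by
  refine M.ext rfl ?_ ?_ rfl (mul_comm _ _)
  · have h1 : ((ElemFrobenioid.Base (φ * ψ)).n : ℚ) =
        ((ElemFrobenioid.Base φ).n : ℚ) * ((ElemFrobenioid.Base ψ).n : ℚ) := by
      show (((show G from ElemFrobenioid.Base φ) * (show G from ElemFrobenioid.Base ψ)).n : ℚ) = _
      rw [G.mul_n, Positive.val_mul]
    have h2 : (Multiplicative.toAdd (ElemFrobenioid.Div (φ * ψ))).1 =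
        (((ElemFrobenioid.Base ψ).n : ℚ))⁻¹ * (Multiplicative.toAdd (ElemFrobenioid.Div φ)).1 +
          ((ElemFrobenioid.degFr φ : ℕ) : ℚ) * (Multiplicative.toAdd (ElemFrobenioid.Div ψ)).1 := by
      show (Multiplicative.toAdd (act' (ElemFrobenioid.Base ψ) (ElemFrobenioid.Div φ) *
          (show Multiplicative (ℚ × ℕ) from ElemFrobenioid.Div ψ) ^ (ElemFrobenioid.degFr φ : ℕ))).1 = _
      simp only [toAdd_mul, toAdd_pow, toAdd_act', Prod.fst_add, Prod.smul_fst]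
      rw [nsmul_eq_mul]
      rfl
    show ((ElemFrobenioid.Base (φ * ψ)).n : ℚ) * (Multiplicative.toAdd (ElemFrobenioid.Div (φ * ψ))).1 =
      ((ElemFrobenioid.Base φ).n : ℚ) * (Multiplicative.toAdd (ElemFrobenioid.Div φ)).1 +
        ((ElemFrobenioid.degFr φ : ℕ) : ℚ) * ((ElemFrobenioid.Base φ).n : ℚ) *
          (((ElemFrobenioid.Base ψ).n : ℚ) * (Multiplicative.toAdd (ElemFrobenioid.Div ψ)).1)
    rw [h1, h2]
    have hψ : ((ElemFrobenioid.Base ψ).n : ℚ) ≠ 0 := ne_of_gt (ElemFrobenioid.Base ψ).n.2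
    field_simp
  · show (Multiplicative.toAdd (act' (ElemFrobenioid.Base ψ) (ElemFrobenioid.Div φ) *
        (show Multiplicative (ℚ × ℕ) from ElemFrobenioid.Div ψ) ^ (ElemFrobenioid.degFr φ : ℕ))).2 = _
    simp only [toAdd_mul, toAdd_pow, toAdd_act', Prod.snd_add, Prod.smul_snd, smul_eq_mul, M.mul_w]
    rfl

/-! ### Addendum (referee PASS-C3, C3-Ff): "the [manifestly non-dilating] monoid on `D`" -/

/-- The pull-back of `Φ` along an arrow of `D` is `act`. [cite: MochizukiFrdI2008, Ex. 3.9 p.72] -/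
theorem pull_Φ (f : SingleObj.star G ⟶ SingleObj.star G) (z : Multiplicative (ℚ × ℕ)) :
    pull Φ f z = act (show G from f) z := rfl

/-- FrdI Ex. 3.9, the bracket "the [manifestly non-dilating] monoid on `D`" (p. 72; PROVED, ref-c C3-Ff):
`Φ(g) = (n, 1)` rescales the `V = ℚ`-coordinate, which consists of units of `V × W`, so `Φ(g)` induces
the identity of `(V × W)^char` and Def. 1.1 (i) holds trivially. [cite: MochizukiFrdI2008, Ex. 3.9 p.72] -/
theorem isNonDilatingOn_Φ : IsNonDilatingOn Φ := by
  intro A f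
  change IsNonDilating (act (show G from f))
  intro _
  refine MonoidHom.ext fun a => ?_
  obtain ⟨x, rfl⟩ := Associates.mk_surjective a
  rw [associatesMap_mk, MonoidHom.id_apply, Associates.mk_eq_mk_iff_associated]
  -- `Φ(f)(x) · (x₁ - n x₁, 0) = x`, and `(s, 0)` is a unit of `V × W`
  let s : ℚ := (Multiplicative.toAdd x).1 - (Multiplicative.toAdd (act (show G from f) x)).1
  refine ⟨⟨Multiplicative.ofAdd (s, 0), Multiplicative.ofAdd (-s, 0), ?_, ?_⟩, ?_⟩
  · rw [← ofAdd_add, Prod.mk_add_mk, add_neg_cancel, add_zero]; rfl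
  · rw [← ofAdd_add, Prod.mk_add_mk, neg_add_cancel, add_zero]; rfl
  · apply Multiplicative.toAdd.injective
    rw [toAdd_mul, Units.val_mk, toAdd_ofAdd]
    refine Prod.ext ?_ ?_
    · show (Multiplicative.toAdd (act (show G from f) x)).1 + s = (Multiplicative.toAdd x).1
      simp only [s]; ring
    · show (Multiplicative.toAdd (act (show G from f) x)).2 + 0 = (Multiplicative.toAdd x).2
      rw [add_zero, toAdd_act]

end Ex39

end Literature.AlgebraicGeometry.Frobenioids
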